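import Summits.QuantumFields.YangMills.Theorems.CurvatureBoostCovariance.Negative.Unbundled
import Summits.QuantumFields.YangMills.Theorems.NPointIsotropy.Negative.NPointRegularJunk
import Summits.QuantumFields.YangMills.Theorems.MirrorModularBoostsCurvatureBoostCovarianceRayPositivityCore
import Summits.QuantumFields.YangMills.Theorems.MirrorModularBoostsPlanarSpectralConeDensityHelpers
import Literature.MathematicalPhysics.QuantumFieldTheory.OSReconstructionNoE1

/-!
# Assembly piece G1 — margins of compactly supported time-ordered test functions; the tube condition from a real gap

Line `Sketch` of crux `MirrorModularBoosts.SoftKernelBoostCovariance` (stmt-QuantumFields-14999): a piece of the LEAD'S ASSEMBLY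
(T7, `stub_chainAssembly` of the registered skeleton `Cruxes/SoftKernelBoostCovariance/Lines/Sketch.lean` + `Lines/SketchAsm.lean`),
landed under the registered conjunction `stub_asmGeometryMargins` (helper package; the assembly's later pieces import this module).

Exported: `geom_margins` (times and consecutive gaps `≥ 4δ`, coordinates `≤ L` on the support) and `tube_of_gap`
(a real rotated gap `≥ g₀` keeps the complexified gap in the planar tube at height `< R` for a reserve `≤ g₀ e^{-R}`).
-/

noncomputable section

namespace Summit.QuantumFields.YangMills.Theorems.SoftKernelBoostCovariance.Sketch

open scoped BigOperators SchwartzMap InnerProductSpace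
open MeasureTheory Filter Topology
open Literature.MathematicalPhysics.QuantumLattice Literature.MathematicalPhysics.AQFT
  Literature.MathematicalPhysics.QuantumFieldTheory
open Summit.QuantumFields.YangMills.Theorems.NPointIsotropy.Negative (E4)
open Summit.QuantumFields.YangMills.Theorems.CurvatureBoostCovariance.Negative
  (OSPackage Translations Hypercubic EightFrameRP PlanarCone PlanarInvariant)
open Summit.QuantumFields.YangMills.Cruxes.PlanarSpectralCone.PositivityDiscToOperatorCone.Density
  (isTimeOrdered_add fieldVec_add fieldVec_smul fieldVec_congr fieldVec_zero tendsto_fieldVec)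

/-- A uniform positive lower bound for finitely many positive reals. -/
theorem exists_pos_le_forall {ι : Type*} [Fintype ι] (d : ι → ℝ) (hd : ∀ i, 0 < d i) :
    ∃ δ : ℝ, 0 < δ ∧ ∀ i, δ ≤ d i := by
  classical
  by_cases hι : Nonempty ι
  · refine ⟨Finset.univ.inf' Finset.univ_nonempty d, ?_, fun i => Finset.inf'_le _ (Finset.mem_univ i)⟩
    obtain ⟨i, -, hi⟩ := Finset.exists_mem_eq_inf' Finset.univ_nonempty d
    rw [hi]; exact hd i
  · exact ⟨1, one_pos, fun i => absurd ⟨i⟩ hι⟩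

/-- A continuous function positive on a compact set has a uniform positive lower bound there. -/
theorem exists_pos_lower_bound {X : Type*} [TopologicalSpace X] {K : Set X} (hK : IsCompact K)
    {f : X → ℝ} (hf : Continuous f) (hpos : ∀ x ∈ K, 0 < f x) :
    ∃ δ : ℝ, 0 < δ ∧ ∀ x ∈ K, δ ≤ f x := by
  rcases K.eq_empty_or_nonempty with rfl | hne
  · exact ⟨1, one_pos, fun x hx => absurd hx (Set.notMem_empty x)⟩
  · obtain ⟨x₀, hx₀, hmin⟩ := hK.exists_isMinOn hne hf.continuousOn
    exact ⟨f x₀, hpos x₀ hx₀, fun x hx => hmin hx⟩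

/-- **Margins of a compactly supported `e₀`-time-ordered test function**: times and consecutive time gaps are
`≥ 4δ` and all coordinates are `≤ L` on its support. -/
theorem geom_margins {n : ℕ} (F : 𝓢((Fin n → E4), ℂ)) (hF : IsTimeOrdered F)
    (hFc : HasCompactSupport (F : (Fin n → E4) → ℂ)) :
    ∃ δ L : ℝ, 0 < δ ∧ δ ≤ 1 ∧ 1 ≤ L ∧ ∀ x ∈ tsupport (F : (Fin n → E4) → ℂ),
      (∀ j : Fin n, 4 * δ ≤ x j 0) ∧ (∀ i j : Fin n, i < j → 4 * δ ≤ x j 0 - x i 0) ∧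
      (∀ (j : Fin n) (k : Fin 4), |x j k| ≤ L) := by
  set K := tsupport (F : (Fin n → E4) → ℂ) with hK
  have hKc : IsCompact K := hFc
  -- coordinates are continuous
  have hcont : ∀ (j : Fin n) (k : Fin 4), Continuous fun x : Fin n → E4 => x j k := fun j k =>
    (EuclideanSpace.proj k).continuous.comp (continuous_apply j)
  -- lower bounds for the times and the gaps
  obtain ⟨δ₁, hδ₁, hδ₁le⟩ : ∃ δ₁ : ℝ, 0 < δ₁ ∧ ∀ j : Fin n, ∀ x ∈ K, δ₁ ≤ x j 0 := by
    have h1 : ∀ j : Fin n, ∃ d : ℝ, 0 < d ∧ ∀ x ∈ K, d ≤ x j 0 := fun j =>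
      exists_pos_lower_bound hKc (hcont j 0) fun x hx => (hF hx).1 j
    choose d hd hdle using h1
    obtain ⟨δ₁, hδ₁, hle⟩ := exists_pos_le_forall d hd
    exact ⟨δ₁, hδ₁, fun j x hx => (hle j).trans (hdle j x hx)⟩
  obtain ⟨δ₂, hδ₂, hδ₂le⟩ : ∃ δ₂ : ℝ, 0 < δ₂ ∧ ∀ i j : Fin n, i < j → ∀ x ∈ K, δ₂ ≤ x j 0 - x i 0 := by
    have h1 : ∀ p : Fin n × Fin n, ∃ d : ℝ, 0 < d ∧ (p.1 < p.2 → ∀ x ∈ K, d ≤ x p.2 0 - x p.1 0) := by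
      intro p
      by_cases hp : p.1 < p.2
      · obtain ⟨d, hd, hdle⟩ := exists_pos_lower_bound hKc ((hcont p.2 0).sub (hcont p.1 0))
          fun x hx => sub_pos.2 ((hF hx).2 hp)
        exact ⟨d, hd, fun _ => hdle⟩
      · exact ⟨1, one_pos, fun h => absurd h hp⟩
    choose d hd hdle using h1
    obtain ⟨δ₂, hδ₂, hle⟩ := exists_pos_le_forall d hd
    exact ⟨δ₂, hδ₂, fun i j hij x hx => (hle (i, j)).trans (hdle (i, j) hij x hx)⟩
  -- upper bound for the coordinates
  obtain ⟨L₀, hL₀⟩ : ∃ L₀ : ℝ, ∀ x ∈ K, ‖x‖ ≤ L₀ := by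
    obtain ⟨L₀, hL₀⟩ := hKc.isBounded.exists_norm_le
    exact ⟨L₀, hL₀⟩
  refine ⟨min (min δ₁ δ₂ / 4) 1, max L₀ 1, by positivity, min_le_right _ _, le_max_right _ _, fun x hx => ⟨?_, ?_, ?_⟩⟩
  · intro j
    have := hδ₁le j x hx
    have h4 : 4 * min (min δ₁ δ₂ / 4) 1 ≤ δ₁ := by
      have := min_le_left (min δ₁ δ₂ / 4) 1; have := min_le_left δ₁ δ₂; linarith
    linarith
  · intro i j hij
    have := hδ₂le i j hij x hx
    have h4 : 4 * min (min δ₁ δ₂ / 4) 1 ≤ δ₂ := by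
      have := min_le_left (min δ₁ δ₂ / 4) 1; have := min_le_right δ₁ δ₂; linarith
    linarith
  · intro j k
    calc |x j k| = ‖x j k‖ := (Real.norm_eq_abs _).symm
      _ ≤ ‖x j‖ := PiLp.norm_apply_le (x j) k
      _ ≤ ‖x‖ := norm_le_pi_norm x j
      _ ≤ L₀ := hL₀ x hx
      _ ≤ max L₀ 1 := le_max_left _ _

/-- **The tube condition from a real gap.**  If the real rotated time gap `g(x) = cos x·Δ₁ + sin x·Δ₂` is `≥ g₀ > 0`
for `|x| < ε`, then for `ζ = x + iy` with `|y| < R` and a reserve `r ≤ g₀ e^{-R}` the complexified gap stays in the tube: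
`|Im(-sin ζ Δ₁ + cos ζ Δ₂)| < Re(cos ζ Δ₁ + sin ζ Δ₂) - r`. -/
theorem tube_of_gap {Δ₁ Δ₂ g₀ ε R r : ℝ} (hg₀ : 0 < g₀) (hr : r ≤ g₀ * Real.exp (-R))
    (hgap : ∀ x : ℝ, |x| < ε → g₀ ≤ Real.cos x * Δ₁ + Real.sin x * Δ₂)
    {ζ : ℂ} (hζ : |ζ.re| < ε) (hζ' : |ζ.im| < R) :
    |(-Complex.sin ζ * Δ₁ + Complex.cos ζ * Δ₂).im| < (Complex.cos ζ * Δ₁ + Complex.sin ζ * Δ₂).re - r := by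
  set x := ζ.re
  set y := ζ.im
  set g := Real.cos x * Δ₁ + Real.sin x * Δ₂ with hg
  have hgx : g₀ ≤ g := hgap x hζ
  have hre : (Complex.cos ζ * Δ₁ + Complex.sin ζ * Δ₂).re = Real.cosh y * g := by
    have e : ζ = x + y * Complex.I := (Complex.re_add_im ζ).symm
    rw [e, Complex.cos_add_mul_I, Complex.sin_add_mul_I]
    simp only [Complex.add_re, Complex.mul_re, Complex.sub_re, Complex.ofReal_re, Complex.ofReal_im,
      Complex.cos_ofReal_re, Complex.cos_ofReal_im, Complex.sin_ofReal_re, Complex.sin_ofReal_im,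
      Complex.cosh_ofReal_re, Complex.cosh_ofReal_im, Complex.sinh_ofReal_re, Complex.sinh_ofReal_im,
      Complex.I_re, Complex.I_im, Complex.mul_im]
    rw [hg]; ring
  have him : (-Complex.sin ζ * Δ₁ + Complex.cos ζ * Δ₂).im = -(Real.sinh y * g) := by
    have e : ζ = x + y * Complex.I := (Complex.re_add_im ζ).symm
    rw [e, Complex.cos_add_mul_I, Complex.sin_add_mul_I]
    simp only [Complex.add_im, Complex.mul_im, Complex.sub_im, Complex.neg_im, Complex.neg_re, Complex.ofReal_re,
      Complex.ofReal_im, Complex.cos_ofReal_re, Complex.cos_ofReal_im, Complex.sin_ofReal_re, Complex.sin_ofReal_im,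
      Complex.cosh_ofReal_re, Complex.cosh_ofReal_im, Complex.sinh_ofReal_re, Complex.sinh_ofReal_im,
      Complex.I_re, Complex.I_im, Complex.mul_re]
    rw [hg]; ring
  rw [hre, him, abs_neg, abs_mul]
  have hgpos : 0 < g := hg₀.trans_le hgx
  rw [abs_of_pos hgpos]
  -- `cosh y - |sinh y| = e^{-|y|} > e^{-R}`
  have hkey : Real.cosh y - |Real.sinh y| = Real.exp (-|y|) := by
    rw [Real.abs_sinh, ← Real.cosh_abs y, Real.cosh_sub_sinh]
  have hexp : Real.exp (-R) < Real.exp (-|y|) := Real.exp_lt_exp.2 (by linarith)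
  have h1 : r < g * Real.exp (-|y|) :=
    calc r ≤ g₀ * Real.exp (-R) := hr
      _ < g₀ * Real.exp (-|y|) := by gcongr
      _ ≤ g * Real.exp (-|y|) := by gcongr
  nlinarith [hkey, h1, abs_nonneg (Real.sinh y), hgpos]

/-- **Registered helper package `stub_asmGeometryMargins` of the lead's assembly (line `Sketch`)**: the conjunction of
`geom_margins`, `tube_of_gap`. -/
theorem stub_asmGeometryMargins :
    open Literature.MathematicalPhysics.QuantumLattice Literature.MathematicalPhysics.AQFT
      Literature.MathematicalPhysics.QuantumFieldTheory
      Summit.QuantumFields.YangMills.Theorems.CurvatureBoostCovariance.Negative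
      Summit.QuantumFields.YangMills.Theorems.NPointIsotropy.Negative in
    (∀ {n : ℕ} (F : 𝓢((Fin n → E4), ℂ)) (hF : IsTimeOrdered F) (hFc : HasCompactSupport (F : (Fin n → E4) → ℂ)),
      ∃ δ L : ℝ, 0 < δ ∧ δ ≤ 1 ∧ 1 ≤ L ∧ ∀ x ∈ tsupport (F : (Fin n → E4) → ℂ),
          (∀ j : Fin n, 4 * δ ≤ x j 0) ∧ (∀ i j : Fin n, i < j → 4 * δ ≤ x j 0 - x i 0) ∧
          (∀ (j : Fin n) (k : Fin 4), |x j k| ≤ L)) ∧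
    (∀ {Δ₁ Δ₂ g₀ ε R r : ℝ} (hg₀ : 0 < g₀) (hr : r ≤ g₀ * Real.exp (-R)) (hgap : ∀ x : ℝ, |x| < ε → g₀ ≤ Real.cos x * Δ₁ + Real.sin x * Δ₂) {ζ : ℂ} (hζ : |ζ.re| < ε) (hζ' : |ζ.im| < R),
      |(-Complex.sin ζ * Δ₁ + Complex.cos ζ * Δ₂).im| < (Complex.cos ζ * Δ₁ + Complex.sin ζ * Δ₂).re - r) :=
  ⟨@geom_margins, @tube_of_gap⟩

end Summit.QuantumFields.YangMills.Theorems.SoftKernelBoostCovariance.Sketch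

end
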